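import Summits.Ventures.PercRepro.MSRMStarSetup

/-!
# (RM*): the `z`-edge bookkeeping, and «tightening for the partner family ⟹ tightening for `F`»

For a family `M` and an element `z`, the `z`-edges of `M` are the pairs `E, insert z E` of members,
i.e. the members of `partner z M`. Splitting a family by whether `r` lies in a member
(`F = F₀ ⊔ (F₁ + r)`, `F \\ F = X ⊔ (Y + r)` with `X = P` at a complex trace) splits the `z`-edges
for every `z ≠ r` (`card_partner_eq_part0_add_partr`, `card_partner_diffs_eq_diffsX_add_diffsY`).

**The comparison lemma** (Addendum 35, Claim 2 (b)). At a complex trace with `Y = D(K)` and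
`K` of excess one: if `z ≠ r` is a tightening direction of the partner family `K`, then it is a
tightening direction of `F` (`tight_proj_of_tight_proj_partner`). Indeed
`|pe_z Y| = |pe_z K| + 1`, every `z`-edge of `F₁` is one of `P`, every `z`-edge of `F₀` that is
not a `z`-edge of `K` is a `z`-edge of `P` that is not one of `F₁` (an edge of both halves is an
edge of `K`), so `|pe_z (F \\ F)| = |pe_z P| + |pe_z Y| ≥ |pe_z F₁| + |pe_z F₀| + 1
= |pe_z F| + 1`; the reverse inequality is the excess-one count, and Addendum 29's identity
`tight_proj_iff_card_edges` concludes.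
-/

namespace PercRepro.MSTight

open Finset
open scoped FinsetFamily

variable {α : Type*} [DecidableEq α]

section Edges

variable {r z : α}

/-- The `z`-edges of `M + r` (every member of `M` avoiding `r`) are the `z`-edges of `M`, lifted. -/
theorem partner_image_insert (hrz : z ≠ r) {M : Finset (Finset α)} (hM : ∀ A ∈ M, r ∉ A) :
    partner z (M.image (insert r)) = (partner z M).image (insert r) := by
  ext E
  simp only [mem_partner_iff, mem_image]
  constructor
  · rintro ⟨⟨A, hA, rfl⟩, hzE, B, hB, hBE⟩
    refine ⟨A, ⟨hA, fun hzA => hzE (mem_insert_of_mem hzA), ?_⟩, rfl⟩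
    have hrA' : r ∉ insert z A := by
      rw [mem_insert, not_or]
      exact ⟨hrz.symm, hM A hA⟩
    have hB' : B = insert z A := by
      have h1 : (insert r B).erase r = (insert z (insert r A)).erase r := by rw [hBE]
      rwa [erase_insert (hM B hB), Finset.insert_comm, erase_insert hrA'] at h1
    rw [← hB']
    exact hB
  · rintro ⟨A, ⟨hA, hzA, hzA'⟩, rfl⟩
    refine ⟨⟨A, hA, rfl⟩, ?_, insert z A, hzA', ?_⟩
    · rw [mem_insert, not_or]
      exact ⟨hrz, hzA⟩
    · rw [Finset.insert_comm]

/-- Lifting by `r` preserves the number of `z`-edges. -/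
theorem card_partner_image_insert (hrz : z ≠ r) {M : Finset (Finset α)}
    (hM : ∀ A ∈ M, r ∉ A) : (partner z (M.image (insert r))).card = (partner z M).card := by
  rw [partner_image_insert hrz hM]
  apply card_image_of_injOn
  intro A hA B hB hAB
  have hrA := hM A (mem_of_mem_partner (mem_coe.1 hA))
  have hrB := hM B (mem_of_mem_partner (mem_coe.1 hB))
  have h1 : (insert r A).erase r = (insert r B).erase r := by
    have hAB' : insert r A = insert r B := hAB
    rw [hAB']
  rwa [erase_insert hrA, erase_insert hrB] at h1

/-- The `z`-edges of a union of a family avoiding `r` and a family containing `r` split. -/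
theorem partner_union_of_sep (hrz : z ≠ r) {𝒜 ℬ : Finset (Finset α)} (hA : ∀ A ∈ 𝒜, r ∉ A)
    (hB : ∀ B ∈ ℬ, r ∈ B) :
    partner z (𝒜 ∪ ℬ) = partner z 𝒜 ∪ partner z ℬ ∧ Disjoint (partner z 𝒜) (partner z ℬ) := by
  constructor
  · ext E
    simp only [mem_partner_iff, mem_union]
    constructor
    · rintro ⟨hE, hzE, hE'⟩
      rcases hE with hE | hE
      · left
        refine ⟨hE, hzE, ?_⟩
        rcases hE' with h | h
        · exact h
        · exfalso
          rcases mem_insert.1 (hB _ h) with h' | h'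
          · exact hrz h'.symm
          · exact hA E hE h'
      · right
        refine ⟨hE, hzE, ?_⟩
        rcases hE' with h | h
        · exfalso
          exact hA _ h (mem_insert_of_mem (hB E hE))
        · exact h
    · rintro (⟨hE, hzE, hE'⟩ | ⟨hE, hzE, hE'⟩)
      · exact ⟨Or.inl hE, hzE, Or.inl hE'⟩
      · exact ⟨Or.inr hE, hzE, Or.inr hE'⟩
  · rw [disjoint_left]
    intro E h1 h2
    exact hA E (mem_of_mem_partner h1) (hB E (mem_of_mem_partner h2))

/-- `F \\ F = X ⊔ (Y + r)`. -/
theorem diffs_eq_diffsX_union_image (r : α) (F : Finset (Finset α)) :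
    F \\ F = diffsX r F ∪ (diffsY r F).image (insert r) := by
  ext E
  constructor
  · intro hE
    by_cases hr : r ∈ E
    · apply mem_union_right
      have : E ∈ (F \\ F).filter (fun E => r ∈ E) := mem_filter.2 ⟨hE, hr⟩
      rwa [diffs_filter_mem] at this
    · apply mem_union_left
      have : E ∈ (F \\ F).filter (fun E => r ∉ E) := mem_filter.2 ⟨hE, hr⟩
      rwa [diffs_filter_notMem] at this
  · intro hE
    rcases mem_union.1 hE with h | h
    · rw [← diffs_filter_notMem] at h
      exact (mem_filter.1 h).1
    · rw [← diffs_filter_mem] at h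
      exact (mem_filter.1 h).1

/-- `F = F₀ ⊔ (F₁ + r)`. -/
theorem eq_part0_union_image (r : α) (F : Finset (Finset α)) :
    F = part0 r F ∪ (partr r F).image (insert r) := by
  ext A
  constructor
  · intro hA
    by_cases hr : r ∈ A
    · apply mem_union_right
      exact mem_image.2 ⟨A.erase r,
        mem_partr.2 ⟨notMem_erase r A, by rw [insert_erase hr]; exact hA⟩, insert_erase hr⟩
    · apply mem_union_left
      exact mem_part0.2 ⟨hA, hr⟩
  · intro hA
    rcases mem_union.1 hA with h | h
    · exact (mem_part0.1 h).1
    · obtain ⟨B, hB, rfl⟩ := mem_image.1 h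
      exact (mem_partr.1 hB).2

/-- `|pe_z (F \\ F)| = |pe_z X| + |pe_z Y|` for `z ≠ r`. -/
theorem card_partner_diffs_eq_diffsX_add_diffsY (hrz : z ≠ r) (F : Finset (Finset α)) :
    (partner z (F \\ F)).card = (partner z (diffsX r F)).card + (partner z (diffsY r F)).card := by
  rw [diffs_eq_diffsX_union_image r F]
  obtain ⟨heq, hdisj⟩ := partner_union_of_sep hrz (𝒜 := diffsX r F)
    (ℬ := (diffsY r F).image (insert r)) (fun A hA => notMem_of_mem_diffsX hA) (by
      intro B hB
      obtain ⟨y, _, rfl⟩ := mem_image.1 hB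
      exact mem_insert_self r y)
  rw [heq, card_union_of_disjoint hdisj,
    card_partner_image_insert hrz (fun y hy => notMem_of_mem_diffsY hy)]

/-- `|pe_z F| = |pe_z F₀| + |pe_z F₁|` for `z ≠ r`. -/
theorem card_partner_eq_part0_add_partr (hrz : z ≠ r) (F : Finset (Finset α)) :
    (partner z F).card = (partner z (part0 r F)).card + (partner z (partr r F)).card := by
  conv_lhs => rw [eq_part0_union_image r F]
  obtain ⟨heq, hdisj⟩ := partner_union_of_sep hrz (𝒜 := part0 r F)
    (ℬ := (partr r F).image (insert r)) (fun A hA => (mem_part0.1 hA).2) (by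
      intro B hB
      obtain ⟨t, _, rfl⟩ := mem_image.1 hB
      exact mem_insert_self r t)
  rw [heq, card_union_of_disjoint hdisj,
    card_partner_image_insert hrz (fun t ht => (mem_partr.1 ht).1)]

/-- `z`-edges are monotone in the family. -/
theorem partner_subset_partner (z : α) {M N : Finset (Finset α)} (h : M ⊆ N) :
    partner z M ⊆ partner z N := by
  intro E hE
  rw [mem_partner_iff] at hE ⊢
  exact ⟨h hE.1, hE.2.1, h hE.2.2⟩

end Edges

section Comparison

variable {r : α} {F : Finset (Finset α)}

/-- **The comparison lemma.** At a complex trace (`Tight (proj r F)`, `{r} ∈ F`) of an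
excess-one family with `Y = D(K)` and `K` of excess one: a tightening direction `z ≠ r` of the
partner family `K` is a tightening direction of `F`. (No monotonicity is needed: a `z`-edge of
`F₀` that is not one of `K` is not one of `F₁` either.) -/
theorem tight_proj_of_tight_proj_partner (hF : (F \\ F).card = F.card + 1)
    (hP : Tight (proj r F)) (hr : ({r} : Finset α) ∈ F)
    (hY : diffsY r F = partner r F \\ partner r F)
    (hK : (partner r F \\ partner r F).card = (partner r F).card + 1)
    {z : α} (hrz : z ≠ r) (hT : Tight (proj z (partner r F))) : Tight (proj z F) := by
  -- the `z`-edges of `Y`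
  have h1 : (partner z (diffsY r F)).card = (partner z (partner r F)).card + 1 := by
    rw [hY, ← diffsX_inter_diffsY_eq_partner_diffs]
    exact (tight_proj_iff_card_edges hK z).1 hT
  -- inclusions
  have hKF0 : partner z (partner r F) ⊆ partner z (part0 r F) :=
    partner_subset_partner z inter_subset_left
  have hF1P : partner z (partr r F) ⊆ partner z (proj r F) :=
    partner_subset_partner z (fun t ht => RMStar.mem_proj_of_mem_partr ht)
  have h3 : partner z (part0 r F) \ partner z (partner r F) ⊆
      partner z (proj r F) \ partner z (partr r F) := by
    intro e he
    rw [mem_sdiff] at he ⊢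
    obtain ⟨he0, heK⟩ := he
    rw [mem_partner_iff] at he0
    obtain ⟨he0, hze, he0'⟩ := he0
    refine ⟨mem_partner_iff.2 ⟨RMStar.mem_proj_of_mem_part0 he0, hze,
      RMStar.mem_proj_of_mem_part0 he0'⟩, ?_⟩
    intro he1
    rw [mem_partner_iff] at he1
    obtain ⟨he1, _, he1'⟩ := he1
    exact heK (mem_partner_iff.2 ⟨mem_inter.2 ⟨he0, he1⟩, hze, mem_inter.2 ⟨he0', he1'⟩⟩)
  have c1 := card_sdiff_add_card_eq_card hKF0
  have c2 := card_sdiff_add_card_eq_card hF1P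
  have c3 := card_le_card h3
  have e1 := card_partner_diffs_eq_diffsX_add_diffsY hrz F
  rw [diffsX_eq_proj_of_singleton_mem hP hr] at e1
  have e2 := card_partner_eq_part0_add_partr hrz F
  -- the excess-one upper bound on the `z`-edges of `F \\ F`
  have u1 := card_diffs_eq_card_diffs_proj_add z F
  have u2 := card_eq_card_proj_add_card_partner z F
  have u3 := Finset.card_le_card_diffs (proj z F)
  have u4 := diffsX_inter_diffsY_eq_partner_diffs z F
  rw [tight_proj_iff_card_edges hF z, u4]
  rw [u4] at u1
  omega

end Comparison

end PercRepro.MSTight
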